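import Summits.FinalStateConjecture.FinalStateConjecture.Theses.SettleThenCensor
import Summits.FinalStateConjecture.FinalStateConjecture.Theses.CurvatureOrSymmetry
import HarnessLib

/-!
# Birth skeleton (BC3) — crux stmt-FinalStateConjecture-17275 `Theses.SettleThenCensor.SettlingCertifiesCensorship` (rank 3)
# line `birth` (skeleton registrar planner-skel-stmt-FinalStateConjecture-17275-0, 2026-08-17; run/shared/lean/lens3/_common/BC.md §BC3)

THE CRUX (by name, rev 8 of the route file): for EVERY admissible datum `D` (no genericity) and every MGHD
`𝒟`, an honest settled description of the exterior — a `C²` final-state decomposition `d` of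
`O = J⁺(ιX) ∩ I⁻(d.charted)` with `RaysStayInClosure 𝒟 O` (every future-complete normalised null ray from
the data stays in `closure O`), `HasExhaustiveCharts d` (honest growing near-zone radii `Rᵢ`, certified slabs
exhaust `O` for EVERY chart time `τ₁ > τ₀`) and `IsFutureOriented d`; sub-extremality NOT assumed — forces
complete future null infinity in Christodoulou's SOJOURN form `Summit.FinalStateConjecture.HasCompleteNullInfinity`
(`∃ B₀ ⋐ Σ, ∀ s > 0, ∃ B₁ ⋐ Σ`, every normalised future null ray from `p ∉ B₁` is future complete or sojourns
`≥ s` in `J⁺(ι B₀)`).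

THE CUT — contrapositive, through the tree's VISIBILITY idiom (`Literature/…/VisibleIncompleteNullRay.lean`:
an event is visible iff it lies in `I⁻` of the nonnegative half of a future-COMPLETE normalised null ray from
the data; a visible future-incomplete null geodesic is a naked singularity in Penrose's sense). If `𝓘⁺` were
incomplete, the far exterior would exhibit a visible future-incomplete null geodesic (stub V); in an exhaustively
charted development such a geodesic is eventually inside every certified late region (stub O, causal structure);
but a null geodesic that outruns every certified slab has unbounded chart time, hence — this is the analytic
heart — unbounded affine parameter (stub B); contradiction. Three stubs:

* `stub_visibleIncompleteRay` (V — THE KLAINERMAN–NICOLÒ BRIDGE; L, open-problem grade as typed): VERBATIM the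
  open item `Theses.CurvatureOrSymmetry.VisibleIncompleteRay` (stmt-FinalStateConjecture-10213, route
  CurvatureOrSymmetry, support rank 9; `sig_stub_visibleIncompleteRay_iff` below is `Iff.rfl`): an MGHD of an
  admissible datum with INCOMPLETE sojourn-`𝓘⁺` contains a future-incomplete maximal null geodesic all of whose
  nonnegative-parameter points are visible. Content: the sojourn negation gives far incomplete normalised rays
  (landed definition chase `exists_normalisedNullRay_bddAbove_of_not_hasCompleteNullInfinity`,
  Theorems/CurvatureOrSymmetryVisibleIncompleteRay.lean); exterior stability of the asymptotically flat end
  (Klainerman–Nicolò 2003 Thm 1.1, Shen arXiv:2211.15230) makes their points visible. Shared by name with route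
  CurvatureOrSymmetry — one proof closes both uses.
* `stub_dyingRaysOutrunSlabs` (O — COVERAGE / CAUSAL STRUCTURE; M–L): under the decomposition, with the radii `R`
  of `HasExhaustiveCharts` unbundled, every VISIBLE future-incomplete maximal null geodesic `γ` (`0 ∈ dom`,
  `BddAbove dom`, null future-directed velocities, `γ t` visible for `t ≥ 0`) is, for every chart time
  `τ₁ > τ₀`, EVENTUALLY INSIDE the certified late region `certifiedLate d R τ₁` (flat chart's image of `{x⁰ > τ₁}`
  plus the hole charts' images of `{t*ᵢ > τ₁, rᵢ ≤ Rᵢ(t*ᵢ)}`). Content: a future-inextendible causal curve of a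
  Cauchy development eventually lies in `J⁺(ιX)`; visible points of `J⁺(ιX)` form the outer region, which
  `RaysStayInClosure` places inside `O` (landed: `EndVisible.outerRegion_subset_exteriorOf_of_raysStayInClosure`);
  exhaustiveness puts uncertified points of `O` into `J⁻(certifiedSlab d R τ₁)`; `γ` cannot be imprisoned in
  `J⁺(γ t₀) ∩ J⁻(certified slab)` (compact for late `τ₁`: finitely many achronal, uniformly spacelike,
  asymptotically Euclidean slab pieces; no imprisonment in globally hyperbolic spacetimes), and once chronologically
  above all `N + 1` pieces it never returns below them.
* `stub_noInfiniteBlueshift` (B — KINEMATIC COMPARISON, the analytic heart; L): under the decomposition, a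
  future-directed maximal null geodesic which is eventually inside `certifiedLate d R τ₁` for EVERY `τ₁ > τ₀`
  (chart time unbounded along it) is future complete (`¬ BddAbove dom`). Content: in the certified regions the
  pulled-back metric is `C²`-close to Minkowski / boosted Kerr on late slabs, so the chart-time rate
  `E = dx⁰/dλ` obeys `|dE/dx⁰| ≲ ε(x⁰) E`; completeness needs `∫ dx⁰ / E = ∞`, i.e. no infinite blue-shift along
  the geodesic — automatic for integrable (Price-law, polynomial) rates, NOT for the rate-free `ε(τ) → 0` of the
  typed convergence; to be extracted from `Ric(g) = 0`, the admissible fall-off and the orientation clause, or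
  shown unnecessary. This is exactly the item's recorded why-might-fail, isolated.

Composition (`SettlingCertifiesCensorship_of`, sorry-free, classical logic only): fix the Levi-Civita instance
bound by `HasCompleteNullInfinity`; if the sojourn form failed, V yields a visible future-incomplete null geodesic
`γ`; destructure `HasExhaustiveCharts d` into its radii `R` and three clauses; O makes `γ` eventually inside every
`certifiedLate d R τ₁`; B makes `γ` future complete — contradicting `BddAbove dom`.
`settlingCertifiesCensorship_of_stubs : SettlingCertifiesCensorship` = the crux BY NAME modulo the three stubs.
The `Sig.*` defs are the stub statements verbatim (legend for the binders of the composition); the registered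
stubs themselves are def-free and self-contained (`open … in` prefixes).  Relations: V is used contrapositively
and is not implied by the crux cheaply (it needs exterior stability), nor does it give the crux (it produces a
naked singularity, it does not exclude one); O and B are statements about arbitrary null geodesics of a settled
development, neither mentions the sojourn form; none implies the crux or the summit cheaply (BC3 probes, registrar
NOTES.md: `exact?` "could not close the goal", `simpa`/`unfold; simpa` fail, `aesop` "failed to prove the goal
after exhaustive search", for each stub against both `SettlingCertifiesCensorship` and `FinalStateConjecture`).

Disproof.lean: none exists for this crux at registration (`ledger crux ls stmt-FinalStateConjecture-17275`: no
workfiles); negatives index of the summit: 1 entry (`not_UniformPhotonSphereChannels`, an ODE channel estimate),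
unrelated.  No dead lines recorded for this crux.  Nearest tree material: the landed visibility API
(`VisibleIncompleteNullRay.lean`, `EventHorizon.lean`: `visibleRegion`, `blackHoleRegion`, `outerRegion`),
`Theorems/PhotonSphereChannelsEndVisibleOuterRegion.lean` (outer-region adherence, `RaysStayInClosure` as a set
inclusion), `Theorems/CurvatureOrSymmetryVisibleIncompleteRay.lean` (definition chase of the sojourn negation).
-/

set_option linter.dupNamespace false

noncomputable section

open scoped BigOperators Topology Manifold Classical ContDiff ENNReal
open Filter Set Function TopologicalSpace Literature.Geometry.Lorentzian

namespace Summit.FinalStateConjecture.FinalStateConjecture.Cruxes.SettlingCertifiesCensorship.Birth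

open Summit.FinalStateConjecture.FinalStateConjecture.Theses.SettleThenCensor (SettlingCertifiesCensorship)

/-! ## Legend: the three stub statements as named propositions (verbatim the registered signatures) -/

/-- Statement of `stub_visibleIncompleteRay` (V): verbatim the item `CurvatureOrSymmetry.VisibleIncompleteRay`
(stmt-FinalStateConjecture-10213) — incomplete sojourn-`𝓘⁺` forces a visible future-incomplete null geodesic. -/
def Sig.stub_visibleIncompleteRay : Prop :=
  ∀ (X : Type) [TopologicalSpace X] [ChartedSpace Literature.Geometry.Lorentzian.E3 X] [IsManifold (𝓡 3) ((⊤ : ℕ∞) : WithTop ℕ∞) X] [T2Space X] [SecondCountableTopology X] [ConnectedSpace X], ∀ D ∈ Literature.Geometry.Lorentzian.admissibleVacuumData X, ∀ 𝒟 : Literature.Geometry.Lorentzian.VacuumCauchyDevelopment D, 𝒟.IsMaximal → ¬ Summit.FinalStateConjecture.HasCompleteNullInfinity 𝒟.toCauchyDevelopment → ∀ [𝒟.metric.HasLeviCivita], ∃ (γ : ℝ → 𝒟.carrier) (dom : Set ℝ), (Literature.Geometry.Lorentzian.IsMaximalGeodesicOn 𝒟.metric.leviCivita γ dom ∧ (0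 : ℝ) ∈ dom ∧ BddAbove dom ∧ (∀ t ∈ dom, 𝒟.metric.IsNull (Literature.Geometry.Lorentzian.velocity (𝓡 4) γ t) ∧ 𝒟.timeOrientation.IsFutureDirected (Literature.Geometry.Lorentzian.velocity (𝓡 4) γ t)) ∧ (∀ t ∈ dom, 0 ≤ t → (∃ (p : X) (δ : ℝ → 𝒟.carrier) (s : Set ℝ), 𝒟.metric.IsNormalisedNullRayFrom 𝒟.timeOrientation 𝒟.embed 𝒟.normal p δ s ∧ ¬ BddAbove s ∧ γ t ∈ 𝒟.metric.chronologicalPast 𝒟.timeOrientation (δ '' (s ∩ Set.Ici 0)))))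

/-- Statement of `stub_dyingRaysOutrunSlabs` (O): in an exhaustively charted, future-oriented settled exterior
with the rays clause, a visible future-incomplete null geodesic is eventually inside every certified late region. -/
def Sig.stub_dyingRaysOutrunSlabs : Prop :=
  open Literature.Geometry.Lorentzian in open scoped Manifold ContDiff in ∀ (X : Type) [TopologicalSpace X] [ChartedSpace E3 X] [IsManifold (𝓡 3) ∞ X] [T2Space X] [SecondCountableTopology X] [ConnectedSpace X] (D : InitialDataSet (𝓡 3) X), D ∈ admissibleVacuumData X → ∀ 𝒟 : VacuumCauchyDevelopment D, 𝒟.IsMaximal → ∀ (O : Set 𝒟.carrier) (d : FinalStateDecomposition 𝒟.toSpacetime O 2), O = Summit.FinalStateConjecture.exteriorOf 𝒟.toCauchyDevelopment d.charted → Summit.FinalStateConjecture.RaysStayInClosure 𝒟.toCauchyDevelopment O → Summit.FinalStateConjecture.IsFutureOriented d → ∀ (R : Fin d.N → ℝ → ℝ), (∀ i, Filter.Tendsto (R i) Filter.atTop Filter.atTop ∧ ∀ τ, max (Kerr.rPlus (d.mass i) (d.spin i)) 0 + 1 ≤ R i τ) → (∀ i, Filter.Tendsto (fun τ ↦ 𝒟.toSpacetime.truncDeviationCk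 (d.background i) (d.chart i) 2 (R i τ) τ) Filter.atTop (nhds 0)) → (∀ τ₁ : ℝ, d.τ₀ < τ₁ → O \ Summit.FinalStateConjecture.certifiedLate d R τ₁ ⊆ 𝒟.metric.causalPast 𝒟.timeOrientation (Summit.FinalStateConjecture.certifiedSlab d R τ₁)) → ∀ [𝒟.metric.HasLeviCivita], ∀ (γ : ℝ → 𝒟.carrier) (dom : Set ℝ), IsMaximalGeodesicOn 𝒟.metric.leviCivita γ dom → (0 : ℝ) ∈ dom → BddAbove dom → (∀ t ∈ dom, 𝒟.metric.IsNull (velocity (𝓡 4) γ t) ∧ 𝒟.timeOrientation.IsFutureDirected (velocity (𝓡 4) γ t)) → (∀ t ∈ dom, 0 ≤ t → ∃ (p : X) (δ : ℝ → 𝒟.carrier) (s : Set ℝ), 𝒟.metric.IsNormalisedNullRayFrom 𝒟.timeOrientation 𝒟.embed 𝒟.normal p δ s ∧ ¬ BddAbove s ∧ γ t ∈ 𝒟.metric.chronologicalPast 𝒟.timeOrientation (δ '' (s ∩ Set.Ici 0))) → ∀ τ₁ : ℝ, d.τ₀ < τ₁ → ∃ t₀ ∈ dom, ∀ t ∈ dom,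 t₀ ≤ t → γ t ∈ Summit.FinalStateConjecture.certifiedLate d R τ₁

/-- Statement of `stub_noInfiniteBlueshift` (B): in a settled exterior, a future-directed maximal null geodesic
eventually inside every certified late region is future complete. -/
def Sig.stub_noInfiniteBlueshift : Prop :=
  open Literature.Geometry.Lorentzian in open scoped Manifold ContDiff in ∀ (X : Type) [TopologicalSpace X] [ChartedSpace E3 X] [IsManifold (𝓡 3) ∞ X] [T2Space X] [SecondCountableTopology X] [ConnectedSpace X] (D : InitialDataSet (𝓡 3) X), D ∈ admissibleVacuumData X → ∀ 𝒟 : VacuumCauchyDevelopment D, 𝒟.IsMaximal → ∀ (O : Set 𝒟.carrier) (d : FinalStateDecomposition 𝒟.toSpacetime O 2), O = Summit.FinalStateConjecture.exteriorOf 𝒟.toCauchyDevelopment d.charted → Summit.FinalStateConjecture.RaysStayInClosure 𝒟.toCauchyDevelopment O → Summit.FinalStateConjecture.IsFutureOriented d → ∀ (R : Fin d.N → ℝ → ℝ), (∀ i, Filter.Tendsto (R i) Filter.atTop Filter.atTop ∧ ∀ τ, max (Kerr.rPlus (d.mass i) (d.spin i)) 0 + 1 ≤ R i τ) → (∀ i,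 Filter.Tendsto (fun τ ↦ 𝒟.toSpacetime.truncDeviationCk (d.background i) (d.chart i) 2 (R i τ) τ) Filter.atTop (nhds 0)) → (∀ τ₁ : ℝ, d.τ₀ < τ₁ → O \ Summit.FinalStateConjecture.certifiedLate d R τ₁ ⊆ 𝒟.metric.causalPast 𝒟.timeOrientation (Summit.FinalStateConjecture.certifiedSlab d R τ₁)) → ∀ [𝒟.metric.HasLeviCivita], ∀ (γ : ℝ → 𝒟.carrier) (dom : Set ℝ), IsMaximalGeodesicOn 𝒟.metric.leviCivita γ dom → (0 : ℝ) ∈ dom → (∀ t ∈ dom, 𝒟.metric.IsNull (velocity (𝓡 4) γ t) ∧ 𝒟.timeOrientation.IsFutureDirected (velocity (𝓡 4) γ t)) → (∀ τ₁ : ℝ, d.τ₀ < τ₁ → ∃ t₀ ∈ dom, ∀ t ∈ dom, t₀ ≤ t → γ t ∈ Summit.FinalStateConjecture.certifiedLate d R τ₁) → ¬ BddAbove dom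

/-! ## Registered stubs (`sorry` only here; signatures def-free and self-contained) -/

/-- **V — INCOMPLETE `𝓘⁺` SHOWS A NAKED SINGULARITY** (the Klainerman–Nicolò bridge; verbatim the open item
`Theses.CurvatureOrSymmetry.VisibleIncompleteRay`, stmt-FinalStateConjecture-10213, shared by name).  For every
admissible datum and every MGHD whose future null infinity is INCOMPLETE in the sojourn form
(`¬ HasCompleteNullInfinity`), there is a maximal geodesic `γ` of the Levi-Civita connection on an open interval
`dom ∋ 0`, future incomplete (`BddAbove dom`), with null future-directed velocity at every parameter, such that
every event `γ t`, `t ∈ dom`, `t ≥ 0`, is VISIBLE: it lies in the chronological past of the nonnegative half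
`δ(s ∩ [0, ∞))` of some future-COMPLETE normalised null ray `δ` from the data hypersurface.  Why plausibly true:
the negated sojourn clause yields, for every compact `B₀`, future-incomplete normalised rays from arbitrarily far
out with small sojourn in `J⁺(ι B₀)` (definition chase, landed as
`Theorems.exists_normalisedNullRay_bddAbove_of_not_hasCompleteNullInfinity`); exterior stability of the strongly
asymptotically flat end (the Klainerman–Nicolò / Shen region: complete outgoing cones from large spheres of `X`,
regular up to its future boundary) makes the points of such a far ray visible — every event of the far region has
a complete outgoing ray through its chronological future.  Why it might fail: exterior stability is in print only
for data well above the admissible `o₂(r⁻¹)`, `o₁(r⁻²)` Dafermos–Rodnianski fall-off and regularity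
(KlainermanNicolo2003 Thm 1.1: `O(r^{-3/2-δ})` with four derivatives; arXiv:2211.15230, arXiv:2303.12758), and
the far incomplete ray must be followed to where it stops being far (prover verdict on stmt-10213, 2026-08-16:
open-problem grade, not refutable without an explicit MGHD).  Sources: Christodoulou1999 pp. A26–A27,
KlainermanNicolo2003, arXiv:2211.15230, HawkingEllis1973 §9.2, arXiv:0811.0354 §2.5.4/§2.6.2.  Size: L. -/
theorem stub_visibleIncompleteRay : ∀ (X : Type) [TopologicalSpace X] [ChartedSpace Literature.Geometry.Lorentzian.E3 X] [IsManifold (𝓡 3) ((⊤ : ℕ∞) : WithTop ℕ∞) X] [T2Space X] [SecondCountableTopology X] [ConnectedSpace X], ∀ D ∈ Literature.Geometry.Lorentzian.admissibleVacuumData X, ∀ 𝒟 : Literature.Geometry.Lorentzian.VacuumCauchyDevelopment D, 𝒟.IsMaximal → ¬ Summit.FinalStateConjecture.HasCompleteNullInfinity 𝒟.toCauchyDevelopment → ∀ [𝒟.metric.HasLeviCivita], ∃ (γ : ℝ → 𝒟.carrier) (dom : Set ℝ), (Literature.Geometry.Lorentzian.IsMaximalGeodesicOn 𝒟.metric.leviCivita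 γ dom ∧ (0 : ℝ) ∈ dom ∧ BddAbove dom ∧ (∀ t ∈ dom, 𝒟.metric.IsNull (Literature.Geometry.Lorentzian.velocity (𝓡 4) γ t) ∧ 𝒟.timeOrientation.IsFutureDirected (Literature.Geometry.Lorentzian.velocity (𝓡 4) γ t)) ∧ (∀ t ∈ dom, 0 ≤ t → (∃ (p : X) (δ : ℝ → 𝒟.carrier) (s : Set ℝ), 𝒟.metric.IsNormalisedNullRayFrom 𝒟.timeOrientation 𝒟.embed 𝒟.normal p δ s ∧ ¬ BddAbove s ∧ γ t ∈ 𝒟.metric.chronologicalPast 𝒟.timeOrientation (δ '' (s ∩ Set.Ici 0))))) := by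
  sorry

/-- **O — VISIBLE DYING NULL GEODESICS OUTRUN EVERY CERTIFIED SLAB** (coverage / causal structure).  For every
admissible datum, every MGHD `𝒟`, every `C²` final-state decomposition `d` of `O = J⁺(ιX) ∩ I⁻(d.charted)` with
`RaysStayInClosure 𝒟 O` and `IsFutureOriented d`, and every family of near-zone radii `R` satisfying the three
clauses of `HasExhaustiveCharts` (honest growing radii; truncated `C²` convergence out to `Rᵢ`; for every
`τ₁ > τ₀`, `O ∖ certifiedLate d R τ₁ ⊆ J⁻(certifiedSlab d R τ₁)`): every maximal null geodesic `γ` on `dom ∋ 0`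
which is future INCOMPLETE (`BddAbove dom`), has null future-directed velocities, and is VISIBLE at all parameters
`t ≥ 0` (as in V), is — for every chart time `τ₁ > τ₀` — EVENTUALLY INSIDE the certified late region: there is
`t₀ ∈ dom` with `γ t ∈ certifiedLate d R τ₁` for all `t ∈ dom`, `t ≥ t₀`.  Why plausibly true: a future-inextendible
causal curve of a Cauchy development eventually lies in `J⁺(ιX)`; visible events of `J⁺(ιX)` form the outer region
`J⁺(ιX) ∩ I⁻(complete rays)`, which the rays clause places inside `O` (landed:
`Theorems.EndVisible.outerRegion_subset_exteriorOf_of_raysStayInClosure`,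
Theorems/PhotonSphereChannelsEndVisibleDefs.lean); so exhaustiveness applies along the whole tail of `γ`: an
uncertified tail point lies in `J⁻(certifiedSlab d R τ₁)`; for late `τ₁` the `N + 1` slab pieces are achronal,
uniformly spacelike and asymptotically Euclidean (sup-`C²` closeness on ENTIRE slabs excludes hyperboloidal or
tilting leaves), `J⁺(γ t) ∩ J⁻(pieces)` has compact closure in `M`, a future-inextendible null geodesic is not
imprisoned in a compact set of the globally hyperbolic `𝒟`, and once `γ` is chronologically above all pieces it
can never re-enter their causal past; `certifiedLate` is antitone in `τ₁`, so late `τ₁` suffice.  Why it might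
fail: the `N + 1` chart times are not synchronised and early leaves are unconstrained, so `certifiedSlab d R τ₁`
need not be achronal as a whole and its near-zone pieces are open at the horizon end `rᵢ ↓ r₊`; compactness of
`J⁺(q) ∩ J⁻(slab piece)` and the no-return step must be organised piece by piece from the `C²` slab control, the
orientation clause and `Tendsto Rᵢ atTop atTop` alone (HawkingEllis1973 §6.4–§6.6, Prop. 6.4.7; ONeill1983 Ch. 14,
Lemmas 14.3, 14.6, 14.42; Wald1984 §8.3; Statement.lean audit g6 §D2).  Sources: HawkingEllis1973, ONeill1983,
Wald1984, arXiv:0811.0354 §2.5.4, DafermosLuk2017 Conj. 1 (b).  Size: M–L. -/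
theorem stub_dyingRaysOutrunSlabs : open Literature.Geometry.Lorentzian in open scoped Manifold ContDiff in ∀ (X : Type) [TopologicalSpace X] [ChartedSpace E3 X] [IsManifold (𝓡 3) ∞ X] [T2Space X] [SecondCountableTopology X] [ConnectedSpace X] (D : InitialDataSet (𝓡 3) X), D ∈ admissibleVacuumData X → ∀ 𝒟 : VacuumCauchyDevelopment D, 𝒟.IsMaximal → ∀ (O : Set 𝒟.carrier) (d : FinalStateDecomposition 𝒟.toSpacetime O 2), O = Summit.FinalStateConjecture.exteriorOf 𝒟.toCauchyDevelopment d.charted → Summit.FinalStateConjecture.RaysStayInClosure 𝒟.toCauchyDevelopment O → Summit.FinalStateConjecture.IsFutureOriented d → ∀ (R : Fin d.N → ℝ → ℝ), (∀ i, Filter.Tendsto (R i) Filter.atTop Filter.atTop ∧ ∀ τ, max (Kerr.rPlus (d.mass i) (d.spin i)) 0 + 1 ≤ R i τ) → (∀ i, Filter.Tendsto (fun τ ↦ 𝒟.toSpacetime.truncDeviationCk (d.background i) (d.chart i) 2 (R i τ) τ) Filter.atTop (nhds 0)) → (∀ τ₁ : ℝ, d.τ₀ < τ₁ → O \ Summit.FinalStateConjecture.certifiedLate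 d R τ₁ ⊆ 𝒟.metric.causalPast 𝒟.timeOrientation (Summit.FinalStateConjecture.certifiedSlab d R τ₁)) → ∀ [𝒟.metric.HasLeviCivita], ∀ (γ : ℝ → 𝒟.carrier) (dom : Set ℝ), IsMaximalGeodesicOn 𝒟.metric.leviCivita γ dom → (0 : ℝ) ∈ dom → BddAbove dom → (∀ t ∈ dom, 𝒟.metric.IsNull (velocity (𝓡 4) γ t) ∧ 𝒟.timeOrientation.IsFutureDirected (velocity (𝓡 4) γ t)) → (∀ t ∈ dom, 0 ≤ t → ∃ (p : X) (δ : ℝ → 𝒟.carrier) (s : Set ℝ), 𝒟.metric.IsNormalisedNullRayFrom 𝒟.timeOrientation 𝒟.embed 𝒟.normal p δ s ∧ ¬ BddAbove s ∧ γ t ∈ 𝒟.metric.chronologicalPast 𝒟.timeOrientation (δ '' (s ∩ Set.Ici 0))) → ∀ τ₁ : ℝ, d.τ₀ < τ₁ → ∃ t₀ ∈ dom, ∀ t ∈ dom, t₀ ≤ t → γ t ∈ Summit.FinalStateConjecture.certifiedLate d R τ₁ := by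
  sorry

/-- **B — NO INFINITE BLUE-SHIFT IN THE SETTLED REGION** (kinematic comparison of affine parameter and chart time;
the analytic heart).  For every admissible datum, every MGHD `𝒟`, every `C²` final-state decomposition `d` of
`O = J⁺(ιX) ∩ I⁻(d.charted)` with `RaysStayInClosure 𝒟 O`, `IsFutureOriented d` and radii `R` satisfying the three
clauses of `HasExhaustiveCharts`: every maximal geodesic `γ` on `dom ∋ 0` with null future-directed velocities
which is, for EVERY chart time `τ₁ > τ₀`, eventually inside `certifiedLate d R τ₁` (so the chart times of the
flat / hole charts are unbounded along it) is future COMPLETE, `¬ BddAbove dom`.  Why plausibly true: in the flat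
chart's late image the pulled-back metric is `C²`-close to `η` on the slabs `{x⁰ = τ}`, in a near zone to boosted
Kerr–Schild on `{t*ᵢ = τ, rᵢ ≤ Rᵢ(τ)}` (regular across the horizon, bounded Christoffels), uniformly as `τ → ∞`;
along a null geodesic the chart-time rate `E = dx⁰/dλ` obeys `|dE/dx⁰| ≤ C ε(x⁰) E` with `ε` the slab deviation
(plus, in a near zone, the approximate Killing energy of the Kerr background), so `λ ≥ ∫ dx⁰ / E ≥
∫ exp(-C ∫ ε) dx⁰`, which diverges whenever `∫^τ ε = O(log τ)` — in particular for the polynomial (Price-law)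
rates every known settling theorem provides — and orthochronous motions with `|vᵢ| < 1` bound the Doppler factors
between the `N + 1` charts.  Why it might fail (the item's own why-might-fail, isolated here): the typed
convergence is RATE-FREE (`Tendsto … (𝓝 0)` of sup-slab `C²` deviations), and `∫ exp(-C∫ε)` converges already for
`ε(τ) = 1/log τ`; sup-slab Christoffel smallness is not integrable along a ray, so affine completeness is not purely
kinematic — the missing decay must come from `Ric(g) = 0` with the admissible fall-off (no sustained blue-shift
along exterior null geodesics: arXiv:0811.0354 §2.6.2, Dafermos CQG 22 (2005) §1, ChristodoulouKlainerman1993PMS41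
Ch. 17, KlainermanNicolo2003), or the statement needs the route's foreseen typing repair (rates / pinned flat
chart; KILL CRITERIA of the route header).  Sources: arXiv:0811.0354, Christodoulou1999, arXiv:gr-qc/0403032,
ChristodoulouKlainerman1993PMS41, RodnianskiShlapentokhRothman2023, ONeill1983 Ch. 3 p. 68.  Size: L. -/
theorem stub_noInfiniteBlueshift : open Literature.Geometry.Lorentzian in open scoped Manifold ContDiff in ∀ (X : Type) [TopologicalSpace X] [ChartedSpace E3 X] [IsManifold (𝓡 3) ∞ X] [T2Space X] [SecondCountableTopology X] [ConnectedSpace X] (D : InitialDataSet (𝓡 3) X), D ∈ admissibleVacuumData X → ∀ 𝒟 : VacuumCauchyDevelopment D, 𝒟.IsMaximal → ∀ (O : Set 𝒟.carrier) (d : FinalStateDecomposition 𝒟.toSpacetime O 2), O = Summit.FinalStateConjecture.exteriorOf 𝒟.toCauchyDevelopment d.charted → Summit.FinalStateConjecture.RaysStayInClosure 𝒟.toCauchyDevelopment O → Summit.FinalStateConjecture.IsFutureOriented d → ∀ (R : Fin d.N → ℝ → ℝ), (∀ i, Filter.Tendsto (R i) Filter.atTop Filter.atTop ∧ ∀ τ,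 max (Kerr.rPlus (d.mass i) (d.spin i)) 0 + 1 ≤ R i τ) → (∀ i, Filter.Tendsto (fun τ ↦ 𝒟.toSpacetime.truncDeviationCk (d.background i) (d.chart i) 2 (R i τ) τ) Filter.atTop (nhds 0)) → (∀ τ₁ : ℝ, d.τ₀ < τ₁ → O \ Summit.FinalStateConjecture.certifiedLate d R τ₁ ⊆ 𝒟.metric.causalPast 𝒟.timeOrientation (Summit.FinalStateConjecture.certifiedSlab d R τ₁)) → ∀ [𝒟.metric.HasLeviCivita], ∀ (γ : ℝ → 𝒟.carrier) (dom : Set ℝ), IsMaximalGeodesicOn 𝒟.metric.leviCivita γ dom → (0 : ℝ) ∈ dom → (∀ t ∈ dom, 𝒟.metric.IsNull (velocity (𝓡 4) γ t) ∧ 𝒟.timeOrientation.IsFutureDirected (velocity (𝓡 4) γ t)) → (∀ τ₁ : ℝ, d.τ₀ < τ₁ → ∃ t₀ ∈ dom, ∀ t ∈ dom, t₀ ≤ t → γ t ∈ Summit.FinalStateConjecture.certifiedLate d R τ₁) → ¬ BddAbove dom := by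
  sorry

/-! ## Composition: the crux BY NAME from the three stubs (real proof, no `sorry`) -/

/-- **`SettlingCertifiesCensorship` from V, O, B** — classical logic over the definitions: under the Levi-Civita
instance bound by `HasCompleteNullInfinity`, if the sojourn form failed, V gives a visible future-incomplete null
geodesic `γ`; with the radii `R` of `HasExhaustiveCharts d`, O puts the tail of `γ` inside every certified late
region and B makes `γ` future complete, contradicting `BddAbove dom`. -/
theorem SettlingCertifiesCensorship_of :
    Sig.stub_visibleIncompleteRay → Sig.stub_dyingRaysOutrunSlabs → Sig.stub_noInfiniteBlueshift →
      SettlingCertifiesCensorship := by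
  intro hV hO hB X _ _ _ _ _ _ D hD 𝒟 h𝒟 hset
  obtain ⟨O, d, hOeq, hR, hex, hfo⟩ := hset
  obtain ⟨R, hR₁, hR₂, hR₃⟩ := hex
  -- the crux's conclusion binds the Levi-Civita instance; argue by contradiction under it
  intro inst
  by_contra hne
  have hnot : ¬ Summit.FinalStateConjecture.HasCompleteNullInfinity 𝒟.toCauchyDevelopment :=
    fun h ↦ hne (@h inst)
  obtain ⟨γ, dom, hmax, h0, hbdd, hnull, hvis⟩ := hV X D hD 𝒟 h𝒟 hnot
  have htail : ∀ τ₁ : ℝ, d.τ₀ < τ₁ → ∃ t₀ ∈ dom, ∀ t ∈ dom, t₀ ≤ t →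
      γ t ∈ Summit.FinalStateConjecture.certifiedLate d R τ₁ :=
    hO X D hD 𝒟 h𝒟 O d hOeq hR hfo R hR₁ hR₂ hR₃ γ dom hmax h0 hbdd hnull hvis
  exact hB X D hD 𝒟 h𝒟 O d hOeq hR hfo R hR₁ hR₂ hR₃ γ dom hmax h0 hnull htail hbdd

/-- The crux by name, closed modulo the three registered stubs. -/
theorem settlingCertifiesCensorship_of_stubs : SettlingCertifiesCensorship :=
  SettlingCertifiesCensorship_of stub_visibleIncompleteRay stub_dyingRaysOutrunSlabs stub_noInfiniteBlueshift

/-! ## Sanity: stub V is the route item `CurvatureOrSymmetry.VisibleIncompleteRay` (stmt-10213) by `Iff.rfl` -/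

/-- `Sig.stub_visibleIncompleteRay` is literally the open item `Theses.CurvatureOrSymmetry.VisibleIncompleteRay`
(stmt-FinalStateConjecture-10213): one proof closes both. [folklore] -/
theorem sig_stub_visibleIncompleteRay_iff :
    Sig.stub_visibleIncompleteRay ↔
      Summit.FinalStateConjecture.FinalStateConjecture.Theses.CurvatureOrSymmetry.VisibleIncompleteRay :=
  Iff.rfl

end Summit.FinalStateConjecture.FinalStateConjecture.Cruxes.SettlingCertifiesCensorship.Birth

end
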